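import Summits.Ventures.YMGap.Thresholds.HessianSharp
import Summits.Ventures.YMGap.Thresholds.ExpWordCalculus

/-!
# Venture YMGap — Theorem C assembled: the second variation of the Wilson plaquette sum along
# every exponential curve is at most `4d ‖X‖²`

HONEST FRAMING: venture file (cell `pub-ymgap`, track (a), item A2 = "Theorem C" of
`p2/HESSIAN-SHARP.md`). It combines `HessianSharp.lean` (the algebraic bound
`hessianForm Q X ≤ 4d ‖X‖²`) with `ExpWordCalculus.lean` (the calculus identification of `word2`)
into the statement a reader of Shen–Zhu–Zhu (CMP 400 (2023), Lemma 4.1 and (4.3)) expects: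
for unitary link variables `Q_e` and skew-Hermitian directions `X_e`, with the perturbed
configuration `Q^t_e = e^{tX_e} Q_e`,

  `d²/dt²|_{t=0} Σ_p Re tr( Q^t₁ Q^t₂ (Q^t₃)ᴴ (Q^t₄)ᴴ ) = hessianForm Q X ≤ 4d · Σ_e ‖X_e‖²`

(`iteratedDeriv_two_wilsonRe`, `second_variation_le_four_d`). Since `t ↦ e^{tX}Q` is a geodesic of
the bi-invariant metric, this is the Hessian bound `Hess(Σ_p Re tr hol_p)(X,X) ≤ 4d|X|²`
(HESSIAN-SHARP §3; Shen–Zhu–Zhu's count is `8(d-1)`), hence `|Hess_S| ≤ 4dN|β| |X|²` for the Wilson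
action `S = Nβ Σ_p Re tr hol_p`. What is NOT here: any measure / log-Sobolev / mass-gap statement
(the Bakry–Émery step, T2.2 of `p2/LEAN-TARGETS-A2.md`, stays a named fact of the cell), and the
attainment `= 4d` (HESSIAN-SHARP Prop. D). `wilsonAction_unitary_eq` records how the tree's
`wilsonAction` (ConstructiveQFTWave0) reads in these terms for unitary-group configurations.
-/

noncomputable section

namespace Summit.Ventures.YMGap.HessianSharp

open Matrix Complex NormedSpace Finset
open Literature.MathematicalPhysics.QuantumFieldTheory
open scoped Matrix ComplexConjugate BigOperators

variable {n : Type*} [Fintype n] [DecidableEq n] {d L : ℕ}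

/-- The exponentially perturbed configuration `Q^t_e = e^{tX_e} Q_e`. -/
def perturb (Q X : GaugeConfig d L (Matrix n n ℂ)) (t : ℝ) : GaugeConfig d L (Matrix n n ℂ) :=
  fun e => exp (t • X e) * Q e

/-- The real part of the trace of one plaquette word `Q₁ Q₂ Q₃ᴴ Q₄ᴴ` (links of the plaquette
`(x; i, j)` in the order of `plaquetteHolonomy`; for unitary links `Qᴴ = Q⁻¹`). -/
def plaqRe (Q : GaugeConfig d L (Matrix n n ℂ)) (x : Site d L) (i j : Fin d) : ℝ :=
  (Q (x, i) * Q (x.shift i, j) * (Q (x.shift j, i))ᴴ * (Q (x, j))ᴴ).trace.re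

/-- The Wilson plaquette sum `Σ_p Re tr(Q₁ Q₂ Q₃ᴴ Q₄ᴴ)` over all plaquettes of the torus
(`= Σ_p Re tr hol_p` for unitary links; the Wilson action is `Nβ` times this up to sign and an
additive constant, cf. `wilsonAction_unitary_eq`). -/
def wilsonRe [NeZero L] (Q : GaugeConfig d L (Matrix n n ℂ)) : ℝ :=
  ∑ p : Plaquette d L, plaqRe Q p.1 p.2.1.1 p.2.1.2

/-- The first variation of one plaquette term along `Q^t = e^{tX}Q`, as a function of `t`: the
four first-order words of `hasDerivAt_reTrWord` for `V = (X₁, X₂, -X₃, -X₄)`,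
`B = (Q₁, Q₂Q₃ᴴ, Q₄ᴴ, 1)`. -/
def plaqReDeriv (Q X : GaugeConfig d L (Matrix n n ℂ)) (x : Site d L) (i j : Fin d) (t : ℝ) : ℝ :=
  reTrWord (1 * X (x, i)) (X (x, i)) (Q (x, i)) (X (x.shift i, j))
      (Q (x.shift i, j) * (Q (x.shift j, i))ᴴ) (-X (x.shift j, i)) (Q (x, j))ᴴ (-X (x, j)) 1 t
    + reTrWord 1 (X (x, i)) (Q (x, i) * X (x.shift i, j)) (X (x.shift i, j))
      (Q (x.shift i, j) * (Q (x.shift j, i))ᴴ) (-X (x.shift j, i)) (Q (x, j))ᴴ (-X (x, j)) 1 t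
    + reTrWord 1 (X (x, i)) (Q (x, i)) (X (x.shift i, j))
      (Q (x.shift i, j) * (Q (x.shift j, i))ᴴ * -X (x.shift j, i)) (-X (x.shift j, i)) (Q (x, j))ᴴ
      (-X (x, j)) 1 t
    + reTrWord 1 (X (x, i)) (Q (x, i)) (X (x.shift i, j))
      (Q (x.shift i, j) * (Q (x.shift j, i))ᴴ) (-X (x.shift j, i)) ((Q (x, j))ᴴ * -X (x, j))
      (-X (x, j)) 1 t

/-- For real `t` and skew-Hermitian `X`: `(e^{tX})ᴴ = e^{t(-X)}`. -/
theorem conjTranspose_exp_smul_of_skew {X : Matrix n n ℂ} (hX : Xᴴ = -X) (t : ℝ) :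
    (exp (t • X))ᴴ = exp (t • (-X)) := by
  rw [← Matrix.exp_conjTranspose, conjTranspose_smul, star_trivial, hX]

/-- Along the perturbation, one plaquette term is the exponential word of `ExpWordCalculus` with
`V = (X₁, X₂, -X₃, -X₄)`, `B = (Q₁, Q₂Q₃ᴴ, Q₄ᴴ, 1)` (skew-Hermitian `X₃, X₄`). -/
theorem plaqRe_perturb_eq (Q X : GaugeConfig d L (Matrix n n ℂ)) (x : Site d L) (i j : Fin d)
    (h₃ : (X (x.shift j, i))ᴴ = -X (x.shift j, i)) (h₄ : (X (x, j))ᴴ = -X (x, j)) (t : ℝ) :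
    plaqRe (perturb Q X t) x i j =
      reTrWord 1 (X (x, i)) (Q (x, i)) (X (x.shift i, j)) (Q (x.shift i, j) * (Q (x.shift j, i))ᴴ)
        (-X (x.shift j, i)) (Q (x, j))ᴴ (-X (x, j)) 1 t := by
  simp only [plaqRe, perturb, reTrWord, expWord, conjTranspose_mul,
    conjTranspose_exp_smul_of_skew h₃, conjTranspose_exp_smul_of_skew h₄, Matrix.one_mul,
    Matrix.mul_one, Matrix.mul_assoc]

/-- The first variation of one plaquette term has derivative `plaqHess` at `t = 0`
(`hasDerivAt_deriv_reTrWord_zero` specialised; `plaqHess` is `word2` of these data). -/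
theorem hasDerivAt_plaqReDeriv_zero (Q X : GaugeConfig d L (Matrix n n ℂ)) (x : Site d L)
    (i j : Fin d) : HasDerivAt (plaqReDeriv Q X x i j) (plaqHess Q X x i j) 0 :=
  hasDerivAt_deriv_reTrWord_zero (X (x, i)) (Q (x, i)) (X (x.shift i, j))
    (Q (x.shift i, j) * (Q (x.shift j, i))ᴴ) (-X (x.shift j, i)) (Q (x, j))ᴴ (-X (x, j)) 1

variable [NeZero L]

/-- **First variation** of the plaquette sum along `Q^t = e^{tX}Q` (skew-Hermitian `X`):
`d/dt Σ_p Re tr(…) = Σ_p plaqReDeriv`, at every `t`. -/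
theorem hasDerivAt_wilsonRe_perturb (Q X : GaugeConfig d L (Matrix n n ℂ))
    (hX : ∀ e, (X e)ᴴ = -X e) (t : ℝ) :
    HasDerivAt (fun s => wilsonRe (perturb Q X s))
      (∑ p : Plaquette d L, plaqReDeriv Q X p.1 p.2.1.1 p.2.1.2 t) t := by
  have hfun : (fun s => wilsonRe (perturb Q X s)) = fun s => ∑ p : Plaquette d L,
      reTrWord 1 (X (p.1, p.2.1.1)) (Q (p.1, p.2.1.1)) (X (p.1.shift p.2.1.1, p.2.1.2))
        (Q (p.1.shift p.2.1.1, p.2.1.2) * (Q (p.1.shift p.2.1.2, p.2.1.1))ᴴ)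
        (-X (p.1.shift p.2.1.2, p.2.1.1)) (Q (p.1, p.2.1.2))ᴴ (-X (p.1, p.2.1.2)) 1 s := by
    funext s
    unfold wilsonRe
    exact Finset.sum_congr rfl fun p _ => plaqRe_perturb_eq Q X p.1 p.2.1.1 p.2.1.2 (hX _) (hX _) s
  rw [hfun]
  exact HasDerivAt.fun_sum fun p _ =>
    hasDerivAt_reTrWord 1 (X (p.1, p.2.1.1)) (Q (p.1, p.2.1.1)) (X (p.1.shift p.2.1.1, p.2.1.2))
      (Q (p.1.shift p.2.1.1, p.2.1.2) * (Q (p.1.shift p.2.1.2, p.2.1.1))ᴴ)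
      (-X (p.1.shift p.2.1.2, p.2.1.1)) (Q (p.1, p.2.1.2))ᴴ (-X (p.1, p.2.1.2)) 1 t

/-- The derivative function of the plaquette sum along the perturbation. -/
theorem deriv_wilsonRe_perturb (Q X : GaugeConfig d L (Matrix n n ℂ)) (hX : ∀ e, (X e)ᴴ = -X e) :
    deriv (fun s => wilsonRe (perturb Q X s)) =
      fun t => ∑ p : Plaquette d L, plaqReDeriv Q X p.1 p.2.1.1 p.2.1.2 t :=
  funext fun t => (hasDerivAt_wilsonRe_perturb Q X hX t).deriv

/-- **Second variation = `hessianForm`.** For skew-Hermitian directions `X` (and any `Q`), the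
second derivative at `t = 0` of `t ↦ Σ_p Re tr(Q^t₁ Q^t₂ (Q^t₃)ᴴ (Q^t₄)ᴴ)`, `Q^t = e^{tX}Q`, is the
Hessian form `hessianForm Q X` of `HessianSharp.lean` (Shen–Zhu–Zhu (4.3), all plaquettes). -/
theorem iteratedDeriv_two_wilsonRe (Q X : GaugeConfig d L (Matrix n n ℂ))
    (hX : ∀ e, (X e)ᴴ = -X e) :
    iteratedDeriv 2 (fun t => wilsonRe (perturb Q X t)) 0 = hessianForm Q X := by
  rw [iteratedDeriv_succ, iteratedDeriv_one, deriv_wilsonRe_perturb Q X hX]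
  exact (HasDerivAt.fun_sum fun p _ => hasDerivAt_plaqReDeriv_zero Q X p.1 p.2.1.1 p.2.1.2).deriv

/-- **Theorem C (sharp Hessian constant of the Wilson action), assembled.** On the torus
`(ℤ/L)^d` (any `d`, `L ≥ 1`, `n`), for unitary link variables `Q_e` and skew-Hermitian directions
`X_e`: the second variation of `Σ_p Re tr hol_p` along `t ↦ e^{tX}Q` is at most `4d · Σ_e ‖X_e‖²`.
For the Wilson action `S = Nβ Σ_p Re tr hol_p` this is `|Hess_S(X,X)| ≤ 4dN|β| |X|²`
(Shen–Zhu–Zhu, CMP 400 (2023), Lemma 4.1 has `8(d-1)N|β|`); the Bakry–Émery consequences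
(`K_S > 0` for `|β| < 1/(8d)`) are NOT drawn in this file. -/
theorem second_variation_le_four_d (Q X : GaugeConfig d L (Matrix n n ℂ))
    (hQ : ∀ e, Q e ∈ Matrix.unitaryGroup n ℂ) (hX : ∀ e, (X e)ᴴ = -X e) :
    iteratedDeriv 2 (fun t => wilsonRe (perturb Q X t)) 0 ≤ 4 * d * tangentNormSq X := by
  rw [iteratedDeriv_two_wilsonRe Q X hX]
  exact hessianForm_le_four_d Q X hQ

/-- Two-sided form: `|d²/dt²|₀ Σ_p Re tr hol_p(e^{tX}Q)| ≤ 4d · Σ_e ‖X_e‖²` (the window is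
symmetric in the sign of `β`, HESSIAN-SHARP §7(b)). -/
theorem abs_second_variation_le_four_d (Q X : GaugeConfig d L (Matrix n n ℂ))
    (hQ : ∀ e, Q e ∈ Matrix.unitaryGroup n ℂ) (hX : ∀ e, (X e)ᴴ = -X e) :
    |iteratedDeriv 2 (fun t => wilsonRe (perturb Q X t)) 0| ≤ 4 * d * tangentNormSq X := by
  rw [iteratedDeriv_two_wilsonRe Q X hX]
  exact abs_hessianForm_le_four_d Q X hQ

/-- Dictionary with the tree's Wilson action (`ConstructiveQFTWave0.wilsonAction`): for a
configuration `U` with values in the unitary GROUP and the defining representation,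
`wilsonAction = #plaquettes · N − wilsonRe(U)` (so `Hess wilsonAction = −Hess wilsonRe`, and
Shen–Zhu–Zhu's `S = Nβ Σ_p Re tr hol_p = Nβ · wilsonRe`). -/
theorem wilsonAction_unitary_eq {N : ℕ} (U : GaugeConfig d L (Matrix.unitaryGroup (Fin N) ℂ)) :
    wilsonAction (Matrix.unitaryGroup (Fin N) ℂ).subtype U =
      Fintype.card (Plaquette d L) * N - wilsonRe (fun e => (U e : Matrix (Fin N) (Fin N) ℂ)) := by
  unfold wilsonAction wilsonRe plaqRe
  rw [Finset.sum_sub_distrib, Finset.sum_const, Finset.card_univ, nsmul_eq_mul]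
  congr 1

end Summit.Ventures.YMGap.HessianSharp
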